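import Summits.BirchSwinnertonDyer.BirchSwinnertonDyer.Theses.DefiniteGrossPeriodAtTwo
import HarnessLib

/-!
# SKELETON LINE `shifted_halves` for crux 27469 `KolyvaginExactAtTwoShifted` (route DefiniteGrossPeriodAtTwo r502 = LINE 11 child A2;
# shared with GenusKolyvaginAtTwo as aside r503)

line-writer skeleton (linewriter-bsd-wide-1 g0); NOT leaf progress. SHIFTED EXACTNESS #Ш(E/K)[2^∞] = 2^(2(M₀ − t)) on the Δ < 0 frame
(non-CM E, K imaginary quadratic with odd d_K ≠ −3 and the Heegner hypothesis, Kolyvagin's Theorem-B₂ non-square conditions,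
ρ_{E,2^∞} onto, y_K of infinite order with exact 2-divisibility 2^M₀, universal 2^s-divisibility of the derived points P(n) at
indices ≥ s for every s ≤ t, and a depth-(t+1) witness P(n) ∉ 2^(t+1) E(K[n])) — McCallum's structure theorem at p = 2 with
m_∞ = t — is cut into its two HALVES exactly as the sibling route GenusKolyvaginAtTwo cut the unshifted (t = 0, on-cut)
exactness `EquivariantKolyvaginExactAtTwoRT` (23468: halves U_T′ 23469 / L_T 23659, glue 23243 — ALL THREE PROVED, p751649 /
p744020 / p751758) and `KolyvaginExactAtTwoPosDiscT` (halves 25500 / 25501, glue 23380 — proved):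
* stub U (UPPER, annihilation road): #Ш(E/K)[2^∞] ∣ 2^(2(M₀ − t)) — Kolyvagin's annihilator sharpened by the universal divisibility
  (m_∞ ≥ t): the K-frame McCallum bound (McCallum 1991 Thm 5.3/5.8) with the Galois-EQUIVARIANT Čebotarev step at 2 (in-tree
  `equivariantChebotarevAtTwo_of_not_isSquare`, the two non-square clauses) and the bottom-layer control Z₀ ≤ P₁ that closed U_T′
  (GK2 LINE 21 «lagrangian_bottom»: `GenusExact.RationalPairDescent.shaCardDvdPowAtTwoRT_onCut`) — OFF the Sel₂-minimal-twin cut here,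
  which is exactly what is beyond GK2's proved reach (critic #388: «off the cut no engine is on offer»);
* stub L (LOWER, isotropic-span road (E4)): 2^(2(M₀ − t)) ∣ #Ш(E/K)[2^∞] — the depth-(t+1) witness gives m_∞ ≤ t; Kolyvagin's
  eigen-classes at Frob_ℓ = Frob_∞ primes (available since Δ < 0: complex conjugation is a transposition on E[2]) span an ISOTROPIC
  subgroup S ⊂ Ш(E/K)[2^∞] of order 2^(M₀ − t)·(ladder) in each eigenspace, and Cassels–Tate alternation gives #Ш = #S·#S^⊥ ≥ #S²
  (the road of the proved L_T, `GenusExact.PlusDescent.ctOrthogonalAtTwo_of_frame`, p744020), re-run with 2^(t+1) in place of 2.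
Composition PROVED (`Nat.dvd_antisymm`). Both stubs keep the crux's full frame verbatim (U does not bite the witness binders n, d,
hn, hKoly, hPn; L does not bite hT — left in place so the lead may strengthen either half by dropping them, as GK2 did for U_T′).
At t = 0 ON GK2's cut (odd Tamagawa product, an odd multiplicative prime, a globally minimal Sel₂-minimal twin, Q2
`KolyvaginRelationAtTwo` granted) both halves are GK2 THEOREMS — the rung; the DGP consumer (LINE 11 glue, anchors B of rank 0 with
N_B squarefree odd) needs t = 0 OFF that cut. Sorries ONLY inside `stub_*`; nothing asserted; BSD is proved for no curve.
-/

set_option autoImplicit false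

namespace Summit.BirchSwinnertonDyer.BirchSwinnertonDyer.Cruxes.KolyvaginExactAtTwoShifted.ShiftedHalves

/-- [research] stub U — the UPPER half, shifted: on the crux's frame, #Ш(E/K)[2^∞] ∣ 2^(2(M₀ − t)) (Kolyvagin–McCallum annihilation
with m_∞ ≥ t from the universal-divisibility binder hT; equivariant Čebotarev at 2; bottom-layer control off the Sel₂-minimal cut). -/
theorem stub_shaCardDvdPowAtTwoShifted : ∀ (W : WeierstrassCurve ℚ) [W.IsElliptic] [W.IsGloballyMinimal] [NeZero (W.conductorNorm ℤ)], ¬ W.HasCM → W.Δ < 0 → ∀ (K : Type) [Field K] [NumberField K], Literature.NumberTheory.EllipticCurves.IsImaginaryQuadratic K → Odd (NumberField.discr K) → NumberField.discr K ≠ -3 → Literature.NumberTheory.EllipticCurves.SatisfiesHeegnerHypothesis (W.conductorNorm ℤ) K → ¬ IsSquare ((NumberField.discr K : ℚ) * -|W.Δ|) → ¬ IsSquare ((NumberField.discr K : ℚ) * (-(2 * |W.Δ|))) → (∀ n : ℕ, 0 < n → W.HasSurjectiveModNGaloisRep ((2 : ℤ) ^ n)) → ∀ (Dt : Literature.NumberTheory.EllipticCurves.ModularForms.ModularParametrizationData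 W (W.conductorNorm ℤ)) (β : ℤ) (ι : K →+* ℂ) (d₁ : Literature.NumberTheory.EllipticCurves.KolyvaginHeegnerData Dt β ι 1), ¬ IsOfFinAddOrder d₁.derivedPoint → ∀ (M₀ : ℕ), (∃ Q : (W.baseChange (Literature.NumberTheory.EllipticCurves.ringClassField K ι 1)).toAffine.Point, ((2 ^ M₀ : ℕ) : ℤ) • Q = d₁.derivedPoint) → (¬ ∃ Q : (W.baseChange (Literature.NumberTheory.EllipticCurves.ringClassField K ι 1)).toAffine.Point, ((2 ^ (M₀ + 1) : ℕ) : ℤ) • Q = d₁.derivedPoint) → ∀ (t : ℕ), (∀ (s : ℕ), s ≤ t → ∀ (n : ℕ) (d : Literature.NumberTheory.EllipticCurves.KolyvaginHeegnerData Dt β ι n), Squarefree n → (∀ ℓ ∈ n.primeFactors, Literature.NumberTheory.EllipticCurves.Zhang2014.IsKolyvaginPrime (W.conductorNorm ℤ) W K 2 ℓ ∧ s ≤ Literature.NumberTheory.EllipticCurves.Zhang2014.kolyvaginIndex W 2 ℓ) → ∃ Q : (W.baseChange (Literature.NumberTheory.EllipticCurves.ringClassField K ι n)).toAffine.Point, ((2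 ^ s : ℕ) : ℤ) • Q = d.derivedPoint) → ∀ (n : ℕ) (d : Literature.NumberTheory.EllipticCurves.KolyvaginHeegnerData Dt β ι n), Squarefree n → (∀ ℓ ∈ n.primeFactors, Literature.NumberTheory.EllipticCurves.Zhang2014.IsKolyvaginPrime (W.conductorNorm ℤ) W K 2 ℓ ∧ t + 1 ≤ Literature.NumberTheory.EllipticCurves.Zhang2014.kolyvaginIndex W 2 ℓ) → (¬ ∃ Q : (W.baseChange (Literature.NumberTheory.EllipticCurves.ringClassField K ι n)).toAffine.Point, ((2 ^ (t + 1) : ℕ) : ℤ) • Q = d.derivedPoint) → Nat.card (AddCommGroup.primaryComponent (W.baseChange K).sha 2) ∣ 2 ^ (2 * (M₀ - t)) := by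
  sorry

/-- [research] stub L — the LOWER half, shifted: on the crux's frame, 2^(2(M₀ − t)) ∣ #Ш(E/K)[2^∞] (the depth-(t+1) witness gives
m_∞ ≤ t; isotropic Kolyvagin-provenance span + Cassels–Tate alternation, road (E4) of GK2's proved L_T, with 2^(t+1) for 2). -/
theorem stub_powDvdShaCardAtTwoShifted : ∀ (W : WeierstrassCurve ℚ) [W.IsElliptic] [W.IsGloballyMinimal] [NeZero (W.conductorNorm ℤ)], ¬ W.HasCM → W.Δ < 0 → ∀ (K : Type) [Field K] [NumberField K], Literature.NumberTheory.EllipticCurves.IsImaginaryQuadratic K → Odd (NumberField.discr K) → NumberField.discr K ≠ -3 → Literature.NumberTheory.EllipticCurves.SatisfiesHeegnerHypothesis (W.conductorNorm ℤ) K → ¬ IsSquare ((NumberField.discr K : ℚ) * -|W.Δ|) → ¬ IsSquare ((NumberField.discr K : ℚ) * (-(2 * |W.Δ|))) → (∀ n : ℕ, 0 < n → W.HasSurjectiveModNGaloisRep ((2 : ℤ) ^ n)) → ∀ (Dt : Literature.NumberTheory.EllipticCurves.ModularForms.ModularParametrizationData W (W.conductorNorm ℤ)) (β : ℤ) (ι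 : K →+* ℂ) (d₁ : Literature.NumberTheory.EllipticCurves.KolyvaginHeegnerData Dt β ι 1), ¬ IsOfFinAddOrder d₁.derivedPoint → ∀ (M₀ : ℕ), (∃ Q : (W.baseChange (Literature.NumberTheory.EllipticCurves.ringClassField K ι 1)).toAffine.Point, ((2 ^ M₀ : ℕ) : ℤ) • Q = d₁.derivedPoint) → (¬ ∃ Q : (W.baseChange (Literature.NumberTheory.EllipticCurves.ringClassField K ι 1)).toAffine.Point, ((2 ^ (M₀ + 1) : ℕ) : ℤ) • Q = d₁.derivedPoint) → ∀ (t : ℕ), (∀ (s : ℕ), s ≤ t → ∀ (n : ℕ) (d : Literature.NumberTheory.EllipticCurves.KolyvaginHeegnerData Dt β ι n), Squarefree n → (∀ ℓ ∈ n.primeFactors, Literature.NumberTheory.EllipticCurves.Zhang2014.IsKolyvaginPrime (W.conductorNorm ℤ) W K 2 ℓ ∧ s ≤ Literature.NumberTheory.EllipticCurves.Zhang2014.kolyvaginIndex W 2 ℓ) → ∃ Q : (W.baseChange (Literature.NumberTheory.EllipticCurves.ringClassField K ι n)).toAffine.Point, ((2 ^ s : ℕ) : ℤ) • Q = d.derivedPoint)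 → ∀ (n : ℕ) (d : Literature.NumberTheory.EllipticCurves.KolyvaginHeegnerData Dt β ι n), Squarefree n → (∀ ℓ ∈ n.primeFactors, Literature.NumberTheory.EllipticCurves.Zhang2014.IsKolyvaginPrime (W.conductorNorm ℤ) W K 2 ℓ ∧ t + 1 ≤ Literature.NumberTheory.EllipticCurves.Zhang2014.kolyvaginIndex W 2 ℓ) → (¬ ∃ Q : (W.baseChange (Literature.NumberTheory.EllipticCurves.ringClassField K ι n)).toAffine.Point, ((2 ^ (t + 1) : ℕ) : ℤ) • Q = d.derivedPoint) → 2 ^ (2 * (M₀ - t)) ∣ Nat.card (AddCommGroup.primaryComponent (W.baseChange K).sha 2) := by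
  sorry

/-- **Composition (kernel-checked): `KolyvaginExactAtTwoShifted`** = the route decl
`Theses.DefiniteGrossPeriodAtTwo.KolyvaginExactAtTwoShifted` (item 27469) BY NAME, from the two halves by `Nat.dvd_antisymm` —
the same three-line glue as GK2's landed `kolyvaginExactAtTwoPosDiscTOfHalves_proof` / `equivariantKolyvaginExactAtTwoRTOfHalves_proof`.
[cite: Kolyvagin1991MathAnn, Thm. 1] [cite: McCallumLMS1991, §5 Thm. 5.3, Prop. 5.2, Thm. 5.8] [cite: GrossLMS1991, §3, §9] -/
theorem KolyvaginExactAtTwoShifted_of :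
    Summit.BirchSwinnertonDyer.BirchSwinnertonDyer.Theses.DefiniteGrossPeriodAtTwo.KolyvaginExactAtTwoShifted := by
  intro W _ _ _ hcm hΔ K _ _ hIQ hodd hd3 hHe hsq1 hsq2 hρ Dt β ι d₁ hy M₀ hdiv hndiv t hT n d hn hKoly hPn
  exact Nat.dvd_antisymm
    (stub_shaCardDvdPowAtTwoShifted W hcm hΔ K hIQ hodd hd3 hHe hsq1 hsq2 hρ Dt β ι d₁ hy M₀ hdiv hndiv t hT n d hn hKoly hPn)
    (stub_powDvdShaCardAtTwoShifted W hcm hΔ K hIQ hodd hd3 hHe hsq1 hsq2 hρ Dt β ι d₁ hy M₀ hdiv hndiv t hT n d hn hKoly hPn)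

end Summit.BirchSwinnertonDyer.BirchSwinnertonDyer.Cruxes.KolyvaginExactAtTwoShifted.ShiftedHalves
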